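import Literature.MathematicalPhysics.QuantumFieldTheory.Balaban1983to89.Node00.Record13CoPR
import Literature.MathematicalPhysics.QuantumFieldTheory.Balaban1983to89.Node00.Record13CarriersSep
import Literature.MathematicalPhysics.QuantumFieldTheory.Balaban1983to89.Node00.Record13CarriersXPinnedH

/-!
# NODE 00 (YM-PLAN Track A) — THE STAGE-13 CARRIER STACK AT THE v1.6 `CoPR` RECORD (node00-def-T's RECORD 13 v1.6 edition `Node00/Record13CoPR` — director-ym №169 RULING H1 on def-T's LOCATED-8
# «the residual 𝐓-weight slot `Stage12Params.Zt` is RUN-BLIND; print's ζ(Ω₁ᶜ) reads the run» + №174 PRESS WORD: the params layer `Stage13RParams` = `Stage13Params` + ONE run-indexed slot `Zr`):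
# §0 the R-LEVEL re-binding `Stage13RParams.rebindX` and the ten R-level pins (lifted through `toStage13Params`, `Zr` kept) with their `rfl` faces and the CORE-proviso pins
# `Provisos₁₃CoPR.rebindX ∕ .pin<G>`; §1–§5 the `CoPR` IMAGE of this seat's `Node00/Record13CarriersCoP` (p522195): the Stage-5 view `toStage5₁₃CoPR` commutes with every re-binding and pin
# (`rfl`), the CORE datum `datumOfRecord₁₃CoPR` is UP-SIDE (`rfl`), the CORE record `IsRecordOfRecord₁₃CCoPR` is presented at any re-bound ∕ [B10]- ∕ [B13]- ∕ X-pinned view, N10 is read at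
# the C-binding of the [B13]-pinned view, and the five cumulative VIEWS `view₁₃CoPRB10YZW ∕ view₁₃CoPRB8B10YZW ∕ view₁₃CoPRB12B8B10YZW ∕ view₁₃CoPRB8subB10YZW ∕ view₁₃CoPRB12B8subB10YZW` with
# their leaves by name — the carrier layer every `CoPR ∕ SepCoPR` consumer reads (seat `pub-ymgap-dag-n10-d` g9, the ₁₃ carriers' declarer of record — dag-lead WORDS-130; count-neutral)

NODE 00 RECORD MODULE at Stage 13, v1.6 `CoPR` edition (node00-def-T g19 `Node00/Record13CoPR.lean` p529474 ✓ 11:56:34Z commit 3eadf656eaa8 (865 l., 105 decls, twin sha16 3872ce9e481029e7) — FILE 25: `structure Stage13RParams extends Stage13Params` with the ONE new field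
`Zr : (p : B12.RunParams) → TkResidualW Fam N (FluctV N) p.K` (the residual 𝐓-weight slot RUN-INDEXED, def-T LOCATED-8 ∕ ref-D + ref-H (g1) REAL ∕ director-ym №169 H1), `WtOfRecord₁₃R θ p :=
tkWeightsOfRecordP … p (gOfRecord₁₃ θ.toStage13Params p) (θ.Zr p)`, and the re-issued cone `SLaw₁₃CoPR ∕ TLaw₁₃CoPR ∕ VOfRecord₁₃CoPR ∕ residualOfStage13CoPR ∕ Stage13RParams.toStage5₁₃CoPR ∕
coreOfRecord₁₃CoPR`, the CORE provisos `Stage13RParams.Provisos₁₃CoPR` (the v1.2 core rows with `ztLaws ∕ ztLocal ↦ zrLaws ∕ zrLocal`), `towerOfRecord₁₃CoPR ∕ datumOfRecord₁₃CoPR`, the record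
`IsRecordOfRecord₁₃CCoPR` (+ `isRecordOfRecord₁₃CCoPR_of_eq`, `exists_world_isRecordOfRecord₁₃CCoPR`); token map T₆ `θ.Zt p.K ↦ θ.Zr p`, `CoP ↦ CoPR`, `θ : Stage13Params ↦ θ : Stage13RParams`;
the U-side objects `UbgOfRecord₁₃CoP ∕ suppOfRecord₁₃SepCoP` and every θ-level object (`gOfRecord₁₃`, `EOfRecord₁₃`, `WOfRecord₁₃`, …) UNCHANGED and read at `θ.toStage13Params`) and this seat's
`Node00/Record13Carriers` (p490901: θ-level `rebindX` ∕ pins), `…CarriersB13` (p491215: `pinB13 ∕ pinB13K`, `XB13OfRecord`), `…CarriersXPinned` (p497764: `XPinned₁₃`, `pinX3`), `…CarriersSep` §1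
(p502304), `…CarriersCoP` (p522195 — the v1.5 source of §1–§5, generated image under T₆ by `tools/gen_copr.py`; guarded token rules; nothing else changes).  WHY §0 (the one thing T₆ cannot
supply — INTENT-0 l.19355): at v1.6 the record's parameter is `θ : Stage13RParams`, and Lean does NOT coerce a child structure to its parent in application position, nor does the θ-level
`Stage13Params.rebindX ∕ pin<G>` return an R-parameter; so every carrier face `(θ.rebindX F N X').toStage5₁₃CoPR = (θ.toStage5₁₃CoPR).rebindX F N X'`, every pinned world binding
`w.up P = upOfRecord₅C F N ((θ.pin<G> …).toStage5₁₃CoPR F N) P` of the consumer fleet (dag-n24-c's K1 engine, the node storeys of n05∕n07∕n08∕n10∕n12, dag-n22-e's layer B) and every record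
presentation needs R-LEVEL pins: `Stage13RParams.rebindX θ X' := { θ with toStage13Params := θ.toStage13Params.rebindX F N X' }` and likewise `pinB10 ∕ pinY ∕ pinZ ∕ pinW ∕ pinB8 ∕ pinB12 ∕
pinB8Sub ∕ pinB13 ∕ pinB13K ∕ pinX3` (`pinB10 ∕ pinY ∕ pinZ ∕ pinW ∕ pinB8` as `{ θ with toStage13Params := θ.toStage13Params.pin<G> … }`; the X-pins `pinB12 ∕ pinB8Sub ∕ pinB13 ∕ pinB13K ∕ pinX3` as R-LEVEL RE-BINDINGS — the θ-level shapes of `Record13Carriers(B13 ∕ XPinned)` verbatim, so that `h.rebindX _` and `toStage5₁₃CoPR_rebindX F N θ _` instantiate at them and no face ever compares a pinned group of record against a generic one — the whnf cliff of HANDOFF §g0), with `rfl` faces `rebindX_toStage13Params` (incl. `Zr` kept), `pins_toStage13Params` (×10 —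
so EVERY θ-level face of `Record13Carriers(B13 ∕ XPinned)` applies at `(θ.pin…).toStage13Params` BY NAME), `pinB13_pinX3_Zr`, `pins_eq_rebindX`, `rebindX_faces`, `rebindX_admissible_iff ∕ pins_admissible_iff`
(the θ-level `Iff.rfl` faces at `θ.toStage13Params`), the carrier-blind K0-class guard `guard_rebindX_iff ∕ pinB13_guard_iff ∕ pinX3_guard_iff` (`Iff.rfl`), `WtOfRecord₁₃R_rebindX` (`rfl`: the run-indexed 𝐓-weights read no carrier), and the CORE-proviso pins `Provisos₁₃CoPR.rebindX ∕ .pinB10 ∕ … ∕ .pinX3` (field by field over FILE 25's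
rows; the v1.5 analogues are `Record13CarriersSep` §1's `Provisos₁₃Core.*`).  dag-n05-d's `pinB8SubB ∕ pinB8SubBH ∕ pinX3H ∕ pinX3HS` and other seats' θ-level pins lift the same way (one
`{ θ with toStage13Params := … }` line each; theirs by the one-declarer rule).  THEN §1 `Stage13RParams.toStage5₁₃CoPR_rebindX ∕ _pinB10 ∕ _pinY ∕ _pinZ ∕ _pinW ∕ _pinB8 ∕ _pinB12_pinB8Sub ∕ _pinB13 ∕
_pinX3` (`rfl` ∕ instances), `SLaw₁₃CoPR_TLaw₁₃CoPR_rebindX`, `Stage13RParams.pinX3_lawsCoPR`; §2 `datumOfRecord₁₃CoPR_rebindX ∕ _pin<G>` (ten; ALL `rfl` — UP-SIDE; key `h : θ.Provisos₁₃CoPR` and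
§0's pins); §3 `isRecordOfRecord₁₃CCoPR_rebindX_of_eq ∕ _pinB10_of_eq ∕ _pinB13_of_eq ∕ _pinX3_of_eq`, `exists_world_isRecordOfRecord₁₃CCoPR_rebindX ∕ _pinX3`; §4 N10 at the [B13]-pinned view
`b13_main_iff_toStage5₁₃CoPR_pinB13 ∕ b13_main_at_toStage5₁₃CoPR_pinB13`; §5 the five views (definitions) with `view₁₃CoPRB10YZW_eq` and the leaves `upOfRecord₅C_view₁₃CoPRB10YZW_leaves`,
`upOfRecord₅CS_view₁₃CoPRB8B10YZW_leaves ∕ …B12B8B10YZW… ∕ …B8subB10YZW… ∕ …B12B8subB10YZW…`, `upOfRecord₅C_view₁₃CoPRB8B10YZW_b8_iff ∕ …B8subB10YZW_b8_iff`.  The node leaves (`b8 ∕ b9 ∕ b10 ∕ b11 ∕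
b12 ∕ b13 ∕ rBasicStep`) of a view are the SAME carriers' leaves as before — only `rOperation` and the laws `SLaw ∕ TLaw` read the background and the 𝐓-weights.  APPEND-ONLY: a NEW importing leaf;
nothing landed is edited; the v1.5 `CoP` files stand (old `Zt` stays; every landed file keeps compiling, №169 (1)).
[Balaban1988Convergent] = Commun. Math. Phys. **119** (1988) 243–285; [Balaban1989LargeFieldII] = Commun. Math. Phys. **122** (1989) 355–392.

HONEST FRAMING: definitions (eleven R-level pins = structure updates of landed pins; five views = compositions of landed pins) + kernel bookkeeping (`rfl`, `Iff.rfl`, anonymous-constructor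
records, structure-instance re-keying); NO estimate; nothing of Bałaban's asserted; no proviso inhabited; no node discharged; counts unmoved (typed 28∕28 · discharged 5∕27); a typing-
faithfulness repair of ONE slot's INDEX in a CONDITIONAL record; one finite T⁴ programme at fixed ε — NOT continuum ∕ ℝ⁴ ∕ OS ∕ mass gap ∕ Clay.  No `sorry`, no `axiom`, no `instance`, no `notation`.
-/

noncomputable section

namespace Literature.MathematicalPhysics.QuantumFieldTheory.Balaban1983to89.Node00

open T4Continuum AveragingRT T4FiniteEpsInhabited FlowStep FlowStepRuns DagBinding T4DatumAssembly
open B8LeafKnitRS (B8LeafRS)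
open B15LeafKnitRepr (WOfRepr)
open scoped Matrix.Norms.L2Operator

variable (F : T4Family) (N : ℕ) [NeZero N]


/-! ## §0. THE R-LEVEL RE-BINDING AND PINS of the v1.6 parameters `θ : Stage13RParams` (lifted through `toStage13Params`; the run-indexed residual `Zr` kept) — the one layer a
token map cannot supply: every face below reads `(θ.rebindX F N X').toStage5₁₃CoPR`, and Lean does not coerce `Stage13RParams` to `Stage13Params` in application position -/

section RPins

/-- **The base-change combinator of the v1.6 parameters** (dag-n08-c g16 DESIGN-INPUT-R (B) ∕ dag-lead DEDUP-283 (1) + DEDUP-286 (2): one declarer = this seat): apply a θ-level operation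
`f : Stage13Params F N → Stage13Params F N` to the Stage-13 part and KEEP the run-indexed residual 𝐓-weight slot `Zr` — legal because `Zr`'s type
`(p : B12.RunParams) → TkResidualW F N (FluctV N) p.K` reads no other field (node00-def-T g19's note l.19522). [cite: Balaban1988Convergent, p.244 (bookkeeping)] -/
def Stage13RParams.onBase (θ : Stage13RParams F N) (f : Stage13Params F N → Stage13Params F N) : Stage13RParams F N :=
  { θ with toStage13Params := f θ.toStage13Params }

/-- The base change keeps `Zr` and has the announced Stage-13 part (`rfl` ×2). [cite: Balaban1988Convergent, p.244 (bookkeeping)] -/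
theorem Stage13RParams.onBase_Zr (θ : Stage13RParams F N) (f : Stage13Params F N → Stage13Params F N) :
    (θ.onBase F N f).Zr = θ.Zr ∧ (θ.onBase F N f).toStage13Params = f θ.toStage13Params := ⟨rfl, rfl⟩

/-- **Re-binding the carrier bundle `X` of the v1.6 parameters** (`Record13Carriers.Stage13Params.rebindX` through `onBase`; `Zr`, `ε₂₉` and everything else kept).
[cite: Balaban1988Convergent, p.244 (bookkeeping)] -/
def Stage13RParams.rebindX (θ : Stage13RParams F N) (X' : B12.RunParams → PrintedCarriersR) : Stage13RParams F N :=
  θ.onBase F N (·.rebindX F N X')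

/-- The [B10] pin of the v1.6 parameters (`Stage13Params.pinB10` through `onBase`). [cite: Balaban1985UV3, (1)–(5) p.256 (bookkeeping)] -/
def Stage13RParams.pinB10 (θ : Stage13RParams F N) : Stage13RParams F N := θ.onBase F N (·.pinB10 F N)

/-- The Y pin of the v1.6 parameters (through `onBase`). [cite: Balaban1985BackgroundPropagators, Thm 3.1 p.397 (bookkeeping)] -/
def Stage13RParams.pinY (θ : Stage13RParams F N) (Y₀ : PrintedCarriers9X) : Stage13RParams F N := θ.onBase F N (·.pinY F N Y₀)

/-- The Z pin of the v1.6 parameters (through `onBase`). [cite: Balaban1985Variational, Thm 1 p.279 (bookkeeping)] -/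
def Stage13RParams.pinZ (θ : Stage13RParams F N) (Z₀ : PrintedCarriers11) : Stage13RParams F N := θ.onBase F N (·.pinZ F N Z₀)

/-- The W pin of the v1.6 parameters (through `onBase`). [cite: Balaban1989LargeFieldI, (0.2) p.176 (bookkeeping)] -/
def Stage13RParams.pinW (θ : Stage13RParams F N) (W₀ : B12.RunParams → PrintedCarriers15) : Stage13RParams F N := θ.onBase F N (·.pinW F N W₀)

/-- The [B8] pin of the v1.6 parameters (a structure update — its datum `lam : ResidB8 θ.toStage3Params` is θ-DEPENDENT, so it is not an `onBase` of a θ-free map).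
[cite: Balaban1985RegularSpaces, Thm 2 p.83 (bookkeeping)] -/
def Stage13RParams.pinB8 (θ : Stage13RParams F N) (lam : ResidB8 θ.toStage3Params) : Stage13RParams F N :=
  { θ with toStage13Params := θ.toStage13Params.pinB8 F N lam }

/-- The [B12] pin of the v1.6 parameters (an R-level `X`-re-binding, as `Record13Carriers.Stage13Params.pinB12` is definitionally; the [B12] frame of record is the Stage-12 one `F12OfRecord₁₂ θ.toStage12Params`). [cite: Balaban1987RG1, Lemma 4 p.280 (objects of record)] -/
def Stage13RParams.pinB12 (θ : Stage13RParams F N) (lam : ResidB12 F N θ.τ9.M) : Stage13RParams F N :=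
  θ.rebindX F N (XB12OfRecord₁₂ F N θ.toStage12Params lam θ.res.X)

/-- The [B8′] pin of the v1.6 parameters (an R-level `X`-re-binding over g32's `withB8OfRecordSub`). [cite: Balaban1985RegularSpaces, Thm 2 p.83 (objects of record)] -/
def Stage13RParams.pinB8Sub (θ : Stage13RParams F N) (lam : ResidB8 θ.toStage3Params) : Stage13RParams F N :=
  θ.rebindX F N fun P => (θ.res.X P).withB8OfRecordSub θ.toStage3Params lam

/-- The [B13] pin of the v1.6 parameters (an R-level `X`-re-binding over node00-def-B13's `XB13OfRecord`, exactly as `Record13CarriersB13.Stage13Params.pinB13`). [cite: Balaban1988RG2Cluster, Lemmas 1–3 pp.9–20 (objects of record)] -/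
def Stage13RParams.pinB13 (θ : Stage13RParams F N) (lam : B12.RunParams → ResidB13 θ.toStage3Params) : Stage13RParams F N :=
  θ.rebindX F N (XB13OfRecord θ.toStage3Params lam θ.res.X)

/-- The kernel-keyed [B13] pin of the v1.6 parameters (`pinB13` at the layers of kernel-keyed layers, as `Record13CarriersB13.Stage13Params.pinB13K`). [cite: Balaban1988RG2Cluster, Lemmas 1–3 pp.9–20, (2.14) p.15 (objects of record)] -/
def Stage13RParams.pinB13K (θ : Stage13RParams F N) (lamK : B12.RunParams → ResidB13K θ.toStage3Params) : Stage13RParams F N :=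
  θ.pinB13 F N fun P => (lamK P).layer

/-- The one-level X-pin of the three carrier groups of record of the v1.6 parameters (an R-level re-binding over `Record13CarriersXPinned.XPinned₁₃ θ.toStage13Params`, as `Stage13Params.pinX3`). [cite: Balaban1988Convergent, p.244 (bookkeeping)] -/
def Stage13RParams.pinX3 (θ : Stage13RParams F N) (lam8 : ResidB8 θ.toStage3Params) (lam12 : ResidB12 F N θ.τ9.M)
    (lam13 : B12.RunParams → ResidB13 θ.toStage3Params) : Stage13RParams F N :=
  θ.rebindX F N (XPinned₁₃ F N θ.toStage13Params lam8 lam12 lam13)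

/-- The REPAIRED one-level X-pin of the v1.6 parameters (an R-level re-binding over dag-n05-d's `Record13CarriersXPinnedH.XPinned₁₃H θ.toStage13Params` — the surviving [B8″H] group —,
as `Stage13Params.pinX3H`; lifted here by dag-lead DEDUP-286 (2) so that the [B8″H] consumers press by token; the θ-level X-pin H stays dag-n05-d's, WORD-XPINH).
[cite: Balaban1985RegularSpaces, Thm 2 p.83; Balaban1988Convergent, p.244 (bookkeeping)] -/
def Stage13RParams.pinX3H (θ : Stage13RParams F N) (lam8 : ResidB8 θ.toStage3Params) (lam12 : ResidB12 F N θ.τ9.M)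
    (lam13 : B12.RunParams → ResidB13 θ.toStage3Params) : Stage13RParams F N :=
  θ.rebindX F N (XPinned₁₃H F N θ.toStage13Params lam8 lam12 lam13)

/-- The Stage-13 part of the re-bound v1.6 parameter IS the re-bound Stage-13 part, and the run-indexed residual is kept (`rfl` ×2). [cite: Balaban1988Convergent, p.244 (bookkeeping)] -/
theorem Stage13RParams.rebindX_toStage13Params (θ : Stage13RParams F N) (X' : B12.RunParams → PrintedCarriersR) :
    (θ.rebindX F N X').toStage13Params = θ.toStage13Params.rebindX F N X' ∧ (θ.rebindX F N X').Zr = θ.Zr := ⟨rfl, rfl⟩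

/-- The pins' Stage-13 parts ARE the Stage-13 pins (`rfl` ×11) — so every θ-level face of `Record13Carriers(B13 ∕ XPinned(H))` applies at `(θ.pin…).toStage13Params` BY NAME.
[cite: Balaban1989LargeFieldII, Thm 1 p.355 (bookkeeping)] -/
theorem Stage13RParams.pins_toStage13Params (θ : Stage13RParams F N) (Y₀ : PrintedCarriers9X) (Z₀ : PrintedCarriers11) (W₀ : B12.RunParams → PrintedCarriers15)
    (lam8 : ResidB8 θ.toStage3Params) (lam12 : ResidB12 F N θ.τ9.M) (lam13 : B12.RunParams → ResidB13 θ.toStage3Params)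
    (lamK : B12.RunParams → ResidB13K θ.toStage3Params) :
    (θ.pinB10 F N).toStage13Params = θ.toStage13Params.pinB10 F N ∧ (θ.pinY F N Y₀).toStage13Params = θ.toStage13Params.pinY F N Y₀ ∧
      (θ.pinZ F N Z₀).toStage13Params = θ.toStage13Params.pinZ F N Z₀ ∧ (θ.pinW F N W₀).toStage13Params = θ.toStage13Params.pinW F N W₀ ∧
      (θ.pinB8 F N lam8).toStage13Params = θ.toStage13Params.pinB8 F N lam8 ∧ (θ.pinB12 F N lam12).toStage13Params = θ.toStage13Params.pinB12 F N lam12 ∧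
      (θ.pinB8Sub F N lam8).toStage13Params = θ.toStage13Params.pinB8Sub F N lam8 ∧ (θ.pinB13 F N lam13).toStage13Params = θ.toStage13Params.pinB13 F N lam13 ∧
      (θ.pinB13K F N lamK).toStage13Params = θ.toStage13Params.pinB13K F N lamK ∧
      (θ.pinX3 F N lam8 lam12 lam13).toStage13Params = θ.toStage13Params.pinX3 F N lam8 lam12 lam13 ∧
      (θ.pinX3H F N lam8 lam12 lam13).toStage13Params = θ.toStage13Params.pinX3H F N lam8 lam12 lam13 :=
  ⟨rfl, rfl, rfl, rfl, rfl, rfl, rfl, rfl, rfl, rfl, rfl⟩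

/-- The [B13] pin and the two one-level X-pins keep the run-indexed residual 𝐓-weight slot `Zr` (instances of the generic face — never a pinned-vs-generic `rfl`, HANDOFF §g0's whnf cliff; the
pins the N10 storey and the K1-engine closers read). [cite: Balaban1988Convergent, (3.16) p.268, (3.21) p.269 (bookkeeping)] -/
theorem Stage13RParams.pinB13_pinX3_Zr (θ : Stage13RParams F N) (lam8 : ResidB8 θ.toStage3Params) (lam12 : ResidB12 F N θ.τ9.M)
    (lam13 : B12.RunParams → ResidB13 θ.toStage3Params) :
    (θ.pinB13 F N lam13).Zr = θ.Zr ∧ (θ.pinX3 F N lam8 lam12 lam13).Zr = θ.Zr ∧ (θ.pinX3H F N lam8 lam12 lam13).Zr = θ.Zr :=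
  ⟨(Stage13RParams.rebindX_toStage13Params F N θ _).2, (Stage13RParams.rebindX_toStage13Params F N θ _).2, (Stage13RParams.rebindX_toStage13Params F N θ _).2⟩

/-- The `X`-pins ARE R-level re-bindings (`rfl` ×6: [B12], [B8′], [B13], kernel [B13], the one-level X-pins). [cite: Balaban1988Convergent, p.244 (bookkeeping)] -/
theorem Stage13RParams.pins_eq_rebindX (θ : Stage13RParams F N) (lam8 : ResidB8 θ.toStage3Params) (lam12 : ResidB12 F N θ.τ9.M)
    (lam13 : B12.RunParams → ResidB13 θ.toStage3Params) (lamK : B12.RunParams → ResidB13K θ.toStage3Params) :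
    θ.pinB12 F N lam12 = θ.rebindX F N (XB12OfRecord₁₂ F N θ.toStage12Params lam12 θ.res.X) ∧
      θ.pinB8Sub F N lam8 = θ.rebindX F N (fun P => (θ.res.X P).withB8OfRecordSub θ.toStage3Params lam8) ∧
      θ.pinB13 F N lam13 = θ.rebindX F N (XB13OfRecord θ.toStage3Params lam13 θ.res.X) ∧
      θ.pinB13K F N lamK = θ.pinB13 F N (fun P => (lamK P).layer) ∧
      θ.pinX3 F N lam8 lam12 lam13 = θ.rebindX F N (XPinned₁₃ F N θ.toStage13Params lam8 lam12 lam13) ∧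
      θ.pinX3H F N lam8 lam12 lam13 = θ.rebindX F N (XPinned₁₃H F N θ.toStage13Params lam8 lam12 lam13) :=
  ⟨rfl, rfl, rfl, rfl, rfl, rfl⟩

/-- The re-bound carrier family, unfolded; the Stage-3 dictionary, `L`, `γ`, `ε₂₉` and the other residual carriers `Y ∕ Z ∕ W` are kept (`rfl` ×7). [cite: Balaban1988Convergent, p.244 (bookkeeping)] -/
theorem Stage13RParams.rebindX_faces (θ : Stage13RParams F N) (X' : B12.RunParams → PrintedCarriersR) (P : B12.RunParams) :
    (θ.rebindX F N X').res.X P = X' P ∧ (θ.rebindX F N X').toStage3Params = θ.toStage3Params ∧ (θ.rebindX F N X').L = θ.L ∧ (θ.rebindX F N X').γ = θ.γ ∧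
      (θ.rebindX F N X').ε₂₉ = θ.ε₂₉ ∧ (θ.rebindX F N X').res.Y = θ.res.Y ∧ ((θ.rebindX F N X').res.Z = θ.res.Z ∧ (θ.rebindX F N X').res.W = θ.res.W) :=
  ⟨rfl, rfl, rfl, rfl, rfl, rfl, rfl, rfl⟩

/-- Admissibility is unchanged by the R-level re-binding and by every R-level pin (`Iff.rfl` ×11; admissibility reads `toStage13Params`). [cite: Balaban1987RG1, (1.20)–(1.21) p.264 (hypothesis dictionary; bookkeeping)] -/
theorem Stage13RParams.rebindX_admissible_iff (θ : Stage13RParams F N) (X' : B12.RunParams → PrintedCarriersR) :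
    (θ.rebindX F N X').Admissible F N ↔ θ.Admissible F N :=
  Stage13Params.rebindX_admissible_iff F N θ.toStage13Params X'

/-- … (the eleven pins; the θ-level faces at `θ.toStage13Params`). [cite: Balaban1987RG1, (1.20)–(1.21) p.264 (bookkeeping)] -/
theorem Stage13RParams.pins_admissible_iff (θ : Stage13RParams F N) (Y₀ : PrintedCarriers9X) (Z₀ : PrintedCarriers11) (W₀ : B12.RunParams → PrintedCarriers15)
    (lam8 : ResidB8 θ.toStage3Params) (lam12 : ResidB12 F N θ.τ9.M) (lam13 : B12.RunParams → ResidB13 θ.toStage3Params)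
    (lamK : B12.RunParams → ResidB13K θ.toStage3Params) :
    ((θ.pinB10 F N).Admissible F N ↔ θ.Admissible F N) ∧ ((θ.pinY F N Y₀).Admissible F N ↔ θ.Admissible F N) ∧
      ((θ.pinZ F N Z₀).Admissible F N ↔ θ.Admissible F N) ∧ ((θ.pinW F N W₀).Admissible F N ↔ θ.Admissible F N) ∧
      ((θ.pinB8 F N lam8).Admissible F N ↔ θ.Admissible F N) ∧ ((θ.pinB12 F N lam12).Admissible F N ↔ θ.Admissible F N) ∧
      ((θ.pinB8Sub F N lam8).Admissible F N ↔ θ.Admissible F N) ∧ ((θ.pinB13 F N lam13).Admissible F N ↔ θ.Admissible F N) ∧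
      ((θ.pinB13K F N lamK).Admissible F N ↔ θ.Admissible F N) ∧ ((θ.pinX3 F N lam8 lam12 lam13).Admissible F N ↔ θ.Admissible F N) ∧
      ((θ.pinX3H F N lam8 lam12 lam13).Admissible F N ↔ θ.Admissible F N) :=
  ⟨Stage13Params.pinB10_admissible_iff F N θ.toStage13Params, Stage13Params.pinY_admissible_iff F N θ.toStage13Params Y₀,
    Stage13Params.pinZ_admissible_iff F N θ.toStage13Params Z₀, Stage13Params.pinW_admissible_iff F N θ.toStage13Params W₀,
    Stage13Params.pinB8_admissible_iff F N θ.toStage13Params lam8, Stage13Params.pinB12_admissible_iff F N θ.toStage13Params lam12,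
    Stage13Params.pinB8Sub_admissible_iff F N θ.toStage13Params lam8, Stage13Params.pinB13_admissible_iff F N θ.toStage13Params lam13,
    Stage13Params.pinB13K_admissible_iff F N θ.toStage13Params lamK, Stage13Params.pinX3_admissible_iff F N θ.toStage13Params lam8 lam12 lam13,
    Stage13Params.pinX3H_admissible_iff F N θ.toStage13Params lam8 lam12 lam13⟩

/-- **The K0-class guard is carrier-blind at the v1.6 parameters**: the run-indexed unity guard and the slots' non-degeneracy are unchanged by the R-level re-binding, hence by the [B13] pin
and the one-level X-pin (`Iff.rfl` ×3; `Zr` and the ₁₃ history are kept). [cite: Balaban1988Convergent, (3.16)–(3.22) pp.268–269 (the guard; bookkeeping)] -/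
theorem Stage13RParams.guard_rebindX_iff (θ : Stage13RParams F N) (X' : B12.RunParams → PrintedCarriersR) :
    ((θ.rebindX F N X').ZrUnity F N ∧ (θ.rebindX F N X').SlotsNondegenerate₁₃ F N) ↔ (θ.ZrUnity F N ∧ θ.SlotsNondegenerate₁₃ F N) := Iff.rfl

/-- … at the [B13] pin … [cite: Balaban1988Convergent, (3.16)–(3.22) pp.268–269 (bookkeeping)] -/
theorem Stage13RParams.pinB13_guard_iff (θ : Stage13RParams F N) (lam13 : B12.RunParams → ResidB13 θ.toStage3Params) :
    ((θ.pinB13 F N lam13).ZrUnity F N ∧ (θ.pinB13 F N lam13).SlotsNondegenerate₁₃ F N) ↔ (θ.ZrUnity F N ∧ θ.SlotsNondegenerate₁₃ F N) :=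
  Stage13RParams.guard_rebindX_iff F N θ _

/-- … at the one-level X-pin … [cite: Balaban1988Convergent, (3.16)–(3.22) pp.268–269 (bookkeeping)] -/
theorem Stage13RParams.pinX3_guard_iff (θ : Stage13RParams F N) (lam8 : ResidB8 θ.toStage3Params) (lam12 : ResidB12 F N θ.τ9.M)
    (lam13 : B12.RunParams → ResidB13 θ.toStage3Params) :
    ((θ.pinX3 F N lam8 lam12 lam13).ZrUnity F N ∧ (θ.pinX3 F N lam8 lam12 lam13).SlotsNondegenerate₁₃ F N) ↔ (θ.ZrUnity F N ∧ θ.SlotsNondegenerate₁₃ F N) :=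
  Stage13RParams.guard_rebindX_iff F N θ _

/-- … and at the repaired one-level X-pin. [cite: Balaban1988Convergent, (3.16)–(3.22) pp.268–269 (bookkeeping)] -/
theorem Stage13RParams.pinX3H_guard_iff (θ : Stage13RParams F N) (lam8 : ResidB8 θ.toStage3Params) (lam12 : ResidB12 F N θ.τ9.M)
    (lam13 : B12.RunParams → ResidB13 θ.toStage3Params) :
    ((θ.pinX3H F N lam8 lam12 lam13).ZrUnity F N ∧ (θ.pinX3H F N lam8 lam12 lam13).SlotsNondegenerate₁₃ F N) ↔ (θ.ZrUnity F N ∧ θ.SlotsNondegenerate₁₃ F N) :=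
  Stage13RParams.guard_rebindX_iff F N θ _

/-- **The run-indexed 𝐓-weights of record read no carrier** (`rfl`: `Zr` and the ₁₃ history are kept by the re-binding). [cite: Balaban1988Convergent, (3.16) p.268, (3.21) p.269 (bookkeeping)] -/
theorem WtOfRecord₁₃R_rebindX (θ : Stage13RParams F N) (X' : B12.RunParams → PrintedCarriersR) :
    WtOfRecord₁₃R F N (θ.rebindX F N X') = WtOfRecord₁₃R F N θ := rfl

variable {F N}

/-- **The CORE provisos of the v1.6 parameters read no carrier**: they transport along ANY `X`-re-binding (field by field; the residual 𝐓-weight rows read `θ.Zr`, kept).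
[cite: Balaban1988Convergent, (2.18) p.257, (2.21) p.258, (3.2)–(3.9) pp.265–266, (3.16) p.268 (bookkeeping)] -/
theorem Stage13RParams.Provisos₁₃CoPR.rebindX {θ : Stage13RParams F N} (h : θ.Provisos₁₃CoPR F N) (X' : B12.RunParams → PrintedCarriersR) :
    (θ.rebindX F N X').Provisos₁₃CoPR F N :=
  { intPiece := h.intPiece, measω := h.measω, measChi := h.measChi, zetaUnity := h.zetaUnity, zetaAbs := h.zetaAbs, rstep := h.rstep, rzLaws := h.rzLaws,
    zrLaws := h.zrLaws, zrLocal := h.zrLocal }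

/-- … along the [B10] pin … [cite: Balaban1988Convergent, (2.18) p.257 (bookkeeping)] -/
theorem Stage13RParams.Provisos₁₃CoPR.pinB10 {θ : Stage13RParams F N} (h : θ.Provisos₁₃CoPR F N) : (θ.pinB10 F N).Provisos₁₃CoPR F N :=
  h.rebindX _

/-- … the Y pin … [cite: Balaban1988Convergent, (2.18) p.257 (bookkeeping)] -/
theorem Stage13RParams.Provisos₁₃CoPR.pinY {θ : Stage13RParams F N} (h : θ.Provisos₁₃CoPR F N) (Y₀ : PrintedCarriers9X) : (θ.pinY F N Y₀).Provisos₁₃CoPR F N :=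
  { intPiece := h.intPiece, measω := h.measω, measChi := h.measChi, zetaUnity := h.zetaUnity, zetaAbs := h.zetaAbs, rstep := h.rstep, rzLaws := h.rzLaws,
    zrLaws := h.zrLaws, zrLocal := h.zrLocal }

/-- … the Z pin … [cite: Balaban1988Convergent, (2.18) p.257 (bookkeeping)] -/
theorem Stage13RParams.Provisos₁₃CoPR.pinZ {θ : Stage13RParams F N} (h : θ.Provisos₁₃CoPR F N) (Z₀ : PrintedCarriers11) : (θ.pinZ F N Z₀).Provisos₁₃CoPR F N :=
  { intPiece := h.intPiece, measω := h.measω, measChi := h.measChi, zetaUnity := h.zetaUnity, zetaAbs := h.zetaAbs, rstep := h.rstep, rzLaws := h.rzLaws,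
    zrLaws := h.zrLaws, zrLocal := h.zrLocal }

/-- … the W pin … [cite: Balaban1988Convergent, (2.18) p.257 (bookkeeping)] -/
theorem Stage13RParams.Provisos₁₃CoPR.pinW {θ : Stage13RParams F N} (h : θ.Provisos₁₃CoPR F N) (W₀ : B12.RunParams → PrintedCarriers15) :
    (θ.pinW F N W₀).Provisos₁₃CoPR F N :=
  { intPiece := h.intPiece, measω := h.measω, measChi := h.measChi, zetaUnity := h.zetaUnity, zetaAbs := h.zetaAbs, rstep := h.rstep, rzLaws := h.rzLaws,
    zrLaws := h.zrLaws, zrLocal := h.zrLocal }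

/-- … the [B8] pin … [cite: Balaban1988Convergent, (2.18) p.257 (bookkeeping)] -/
theorem Stage13RParams.Provisos₁₃CoPR.pinB8 {θ : Stage13RParams F N} (h : θ.Provisos₁₃CoPR F N) (lam : ResidB8 θ.toStage3Params) : (θ.pinB8 F N lam).Provisos₁₃CoPR F N :=
  h.rebindX _

/-- … the [B12] pin … [cite: Balaban1988Convergent, (2.18) p.257 (bookkeeping)] -/
theorem Stage13RParams.Provisos₁₃CoPR.pinB12 {θ : Stage13RParams F N} (h : θ.Provisos₁₃CoPR F N) (lam : ResidB12 F N θ.τ9.M) : (θ.pinB12 F N lam).Provisos₁₃CoPR F N :=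
  h.rebindX _

/-- … the [B8′] pin … [cite: Balaban1988Convergent, (2.18) p.257 (bookkeeping)] -/
theorem Stage13RParams.Provisos₁₃CoPR.pinB8Sub {θ : Stage13RParams F N} (h : θ.Provisos₁₃CoPR F N) (lam : ResidB8 θ.toStage3Params) : (θ.pinB8Sub F N lam).Provisos₁₃CoPR F N :=
  h.rebindX _

/-- … the [B13] pin … [cite: Balaban1988Convergent, (2.18) p.257; Balaban1988RG2Cluster, Lemmas 1–3 pp.9–20 (bookkeeping)] -/
theorem Stage13RParams.Provisos₁₃CoPR.pinB13 {θ : Stage13RParams F N} (h : θ.Provisos₁₃CoPR F N) (lam : B12.RunParams → ResidB13 θ.toStage3Params) :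
    (θ.pinB13 F N lam).Provisos₁₃CoPR F N :=
  h.rebindX _

/-- … the kernel-keyed [B13] pin … [cite: Balaban1988RG2Cluster, Lemmas 1–3 pp.9–20, (2.14) p.15 (bookkeeping)] -/
theorem Stage13RParams.Provisos₁₃CoPR.pinB13K {θ : Stage13RParams F N} (h : θ.Provisos₁₃CoPR F N) (lamK : B12.RunParams → ResidB13K θ.toStage3Params) :
    (θ.pinB13K F N lamK).Provisos₁₃CoPR F N :=
  h.rebindX _

/-- … the one-level X-pin … [cite: Balaban1988Convergent, (2.18) p.257 (bookkeeping)] -/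
theorem Stage13RParams.Provisos₁₃CoPR.pinX3 {θ : Stage13RParams F N} (h : θ.Provisos₁₃CoPR F N) (lam8 : ResidB8 θ.toStage3Params) (lam12 : ResidB12 F N θ.τ9.M)
    (lam13 : B12.RunParams → ResidB13 θ.toStage3Params) : (θ.pinX3 F N lam8 lam12 lam13).Provisos₁₃CoPR F N :=
  h.rebindX _

/-- … and the repaired one-level X-pin. [cite: Balaban1988Convergent, (2.18) p.257 (bookkeeping)] -/
theorem Stage13RParams.Provisos₁₃CoPR.pinX3H {θ : Stage13RParams F N} (h : θ.Provisos₁₃CoPR F N) (lam8 : ResidB8 θ.toStage3Params) (lam12 : ResidB12 F N θ.τ9.M)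
    (lam13 : B12.RunParams → ResidB13 θ.toStage3Params) : (θ.pinX3H F N lam8 lam12 lam13).Provisos₁₃CoPR F N :=
  h.rebindX _

variable (F N)

end RPins

/-! ## §1. The v1.6 Stage-5 view `toStage5₁₃CoPR` commutes with every `X`-re-binding and every pin; the v1.6 laws read no carrier -/

section Faces

/-- **The Stage-13 view commutes with re-binding `X`** (`rfl`, once, at a generic re-binding: `residualOfStage13`'s pinned fields read no carrier).
[cite: Balaban1988Convergent, p.244 (bookkeeping)] -/
theorem Stage13RParams.toStage5₁₃CoPR_rebindX (θ : Stage13RParams F N) (X' : B12.RunParams → PrintedCarriersR) :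
    (θ.rebindX F N X').toStage5₁₃CoPR F N = (θ.toStage5₁₃CoPR F N).rebindX F N X' := rfl

/-- The Stage-13 view of [B10]-pinned parameters IS the [B10]-pinned Stage-13 view (`rfl`). [cite: Balaban1985UV3, (1)–(5) p.256 (bookkeeping)] -/
theorem Stage13RParams.toStage5₁₃CoPR_pinB10 (θ : Stage13RParams F N) : (θ.pinB10 F N).toStage5₁₃CoPR F N = (θ.toStage5₁₃CoPR F N).pinB10 F N :=
  Stage13RParams.toStage5₁₃CoPR_rebindX F N θ _

/-- … Y (`rfl`) … [cite: Balaban1985BackgroundPropagators, Thm 3.1 p.397 (bookkeeping)] -/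
theorem Stage13RParams.toStage5₁₃CoPR_pinY (θ : Stage13RParams F N) (Y₀ : PrintedCarriers9X) : (θ.pinY F N Y₀).toStage5₁₃CoPR F N = (θ.toStage5₁₃CoPR F N).pinY F N Y₀ := rfl

/-- … Z (`rfl`) … [cite: Balaban1985Variational, Thm 1 p.279 (bookkeeping)] -/
theorem Stage13RParams.toStage5₁₃CoPR_pinZ (θ : Stage13RParams F N) (Z₀ : PrintedCarriers11) : (θ.pinZ F N Z₀).toStage5₁₃CoPR F N = (θ.toStage5₁₃CoPR F N).pinZ F N Z₀ := rfl

/-- … W (`rfl`) … [cite: Balaban1989LargeFieldI, (0.2) p.176 (bookkeeping)] -/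
theorem Stage13RParams.toStage5₁₃CoPR_pinW (θ : Stage13RParams F N) (W₀ : B12.RunParams → PrintedCarriers15) :
    (θ.pinW F N W₀).toStage5₁₃CoPR F N = (θ.toStage5₁₃CoPR F N).pinW F N W₀ := rfl

/-- … [B8] (`rfl`) … [cite: Balaban1985RegularSpaces, Thm 2 p.83 (bookkeeping)] -/
theorem Stage13RParams.toStage5₁₃CoPR_pinB8 (θ : Stage13RParams F N) (lam : ResidB8 θ.toStage3Params) :
    (θ.pinB8 F N lam).toStage5₁₃CoPR F N = (θ.toStage5₁₃CoPR F N).pinB8 F N lam :=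
  Stage13RParams.toStage5₁₃CoPR_rebindX F N θ _

/-- … [B12] and [B8′] (`rfl` ×2, through `toStage5₁₃CoPR_rebindX`). [cite: Balaban1988Convergent, p.244 (bookkeeping)] -/
theorem Stage13RParams.toStage5₁₃CoPR_pinB12_pinB8Sub (θ : Stage13RParams F N) (lam : ResidB12 F N θ.τ9.M) (lam8 : ResidB8 θ.toStage3Params) :
    (θ.pinB12 F N lam).toStage5₁₃CoPR F N = (θ.toStage5₁₃CoPR F N).rebindX F N (XB12OfRecord₁₂ F N θ.toStage12Params lam θ.res.X) ∧
    (θ.pinB8Sub F N lam8).toStage5₁₃CoPR F N = (θ.toStage5₁₃CoPR F N).rebindX F N (fun P => (θ.res.X P).withB8OfRecordSub θ.toStage3Params lam8) :=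
  ⟨Stage13RParams.toStage5₁₃CoPR_rebindX F N θ _, Stage13RParams.toStage5₁₃CoPR_rebindX F N θ _⟩

/-- The Stage-13 view of [B13]-pinned parameters IS the re-bound Stage-13 view (`Record13Carriers.Stage13RParams.toStage5₁₃CoPR_rebindX`). [cite: Balaban1988Convergent, p.244 (bookkeeping)] -/
theorem Stage13RParams.toStage5₁₃CoPR_pinB13 (θ : Stage13RParams F N) (lam : B12.RunParams → ResidB13 θ.toStage3Params) :
    (θ.pinB13 F N lam).toStage5₁₃CoPR F N = (θ.toStage5₁₃CoPR F N).rebindX F N (XB13OfRecord θ.toStage3Params lam θ.res.X) :=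
  Stage13RParams.toStage5₁₃CoPR_rebindX F N θ _

/-- The Stage-13 view of the pinned parameter IS the re-bound Stage-13 view (`toStage5₁₃CoPR_rebindX`). [cite: Balaban1988Convergent, p.244 (bookkeeping)] -/
theorem Stage13RParams.toStage5₁₃CoPR_pinX3 (θ : Stage13RParams F N) (lam8 : ResidB8 θ.toStage3Params) (lam12 : ResidB12 F N θ.τ9.M)
    (lam13 : B12.RunParams → ResidB13 θ.toStage3Params) :
    (θ.pinX3 F N lam8 lam12 lam13).toStage5₁₃CoPR F N = (θ.toStage5₁₃CoPR F N).rebindX F N (XPinned₁₃ F N θ.toStage13Params lam8 lam12 lam13) :=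
  Stage13RParams.toStage5₁₃CoPR_rebindX F N θ _

/-- … and of the REPAIRED pinned parameter (`toStage5₁₃CoPR_rebindX` at dag-n05-d's `XPinned₁₃H`). [cite: Balaban1988Convergent, p.244 (bookkeeping)] -/
theorem Stage13RParams.toStage5₁₃CoPR_pinX3H (θ : Stage13RParams F N) (lam8 : ResidB8 θ.toStage3Params) (lam12 : ResidB12 F N θ.τ9.M)
    (lam13 : B12.RunParams → ResidB13 θ.toStage3Params) :
    (θ.pinX3H F N lam8 lam12 lam13).toStage5₁₃CoPR F N = (θ.toStage5₁₃CoPR F N).rebindX F N (XPinned₁₃H F N θ.toStage13Params lam8 lam12 lam13) :=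
  Stage13RParams.toStage5₁₃CoPR_rebindX F N θ _

/-- … nor the §2-format law and the 𝐓-image law of record (`rfl` ×2). [cite: Balaban1988Convergent, (2.18) p.257, Thm 2 p.263 (bookkeeping)] -/
theorem SLaw₁₃CoPR_TLaw₁₃CoPR_rebindX (θ : Stage13RParams F N) (X' : B12.RunParams → PrintedCarriersR) :
    SLaw₁₃CoPR F N (θ.rebindX F N X') = SLaw₁₃CoPR F N θ ∧ TLaw₁₃CoPR F N (θ.rebindX F N X') = TLaw₁₃CoPR F N θ := ⟨rfl, rfl⟩

/-- **The §2-format law and the 𝐓-image law AT PRINT'S BACKGROUND (`SLaw₁₃CoPR`, `TLaw₁₃CoPR`) do not read the carrier bundle either** — at the one-level X-pin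
(instances of `SLaw₁₃CoPR_TLaw₁₃CoPR_rebindX`; the five background-free objects are `pinX3_histories`'). [cite: Balaban1988Convergent, (2.18) p.257, Thm 2 p.263 (bookkeeping)] -/
theorem Stage13RParams.pinX3_lawsCoPR (θ : Stage13RParams F N) (lam8 : ResidB8 θ.toStage3Params) (lam12 : ResidB12 F N θ.τ9.M)
    (lam13 : B12.RunParams → ResidB13 θ.toStage3Params) :
    SLaw₁₃CoPR F N (θ.pinX3 F N lam8 lam12 lam13) = SLaw₁₃CoPR F N θ ∧ TLaw₁₃CoPR F N (θ.pinX3 F N lam8 lam12 lam13) = TLaw₁₃CoPR F N θ :=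
  ⟨(SLaw₁₃CoPR_TLaw₁₃CoPR_rebindX F N θ _).1, (SLaw₁₃CoPR_TLaw₁₃CoPR_rebindX F N θ _).2⟩

end Faces

/-! ## §2. The v1.6 CORE datum `datumOfRecord₁₃CoPR` (key `h : θ.Provisos₁₃CoPR`) is UP-SIDE along every re-binding and pin (`rfl`) -/

section Datum

/-- **THE CORE-KEYED DATUM DOES NOT READ THE CARRIER BUNDLE `X`** (`rfl`, once, at a generic re-binding). [cite: Balaban1989LargeFieldII, Thm 1 + (0.1) pp.355–356 (bookkeeping)] -/
theorem datumOfRecord₁₃CoPR_rebindX (θ : Stage13RParams F N) (h : θ.Provisos₁₃CoPR F N) (X' : B12.RunParams → PrintedCarriersR)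
    (h' : (θ.rebindX F N X').Provisos₁₃CoPR F N) : datumOfRecord₁₃CoPR F N (θ.rebindX F N X') h' = datumOfRecord₁₃CoPR F N θ h := rfl

/-- The [B10] pin is UP-SIDE at the core-keyed datum (`rfl`) … [cite: Balaban1989LargeFieldII, Thm 1 + (0.1) pp.355–356 (bookkeeping)] -/
theorem datumOfRecord₁₃CoPR_pinB10 (θ : Stage13RParams F N) (h : θ.Provisos₁₃CoPR F N) :
    datumOfRecord₁₃CoPR F N (θ.pinB10 F N) h.pinB10 = datumOfRecord₁₃CoPR F N θ h :=
  datumOfRecord₁₃CoPR_rebindX F N θ h _ h.pinB10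

/-- … the Y pin (`rfl`) … [cite: Balaban1989LargeFieldII, Thm 1 + (0.1) pp.355–356 (bookkeeping)] -/
theorem datumOfRecord₁₃CoPR_pinY (θ : Stage13RParams F N) (h : θ.Provisos₁₃CoPR F N) (Y₀ : PrintedCarriers9X) :
    datumOfRecord₁₃CoPR F N (θ.pinY F N Y₀) (h.pinY Y₀) = datumOfRecord₁₃CoPR F N θ h := rfl

/-- … the Z pin (`rfl`) … [cite: Balaban1989LargeFieldII, Thm 1 + (0.1) pp.355–356 (bookkeeping)] -/
theorem datumOfRecord₁₃CoPR_pinZ (θ : Stage13RParams F N) (h : θ.Provisos₁₃CoPR F N) (Z₀ : PrintedCarriers11) :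
    datumOfRecord₁₃CoPR F N (θ.pinZ F N Z₀) (h.pinZ Z₀) = datumOfRecord₁₃CoPR F N θ h := rfl

/-- … the W pin (`rfl`) … [cite: Balaban1989LargeFieldII, Thm 1 + (0.1) pp.355–356 (bookkeeping)] -/
theorem datumOfRecord₁₃CoPR_pinW (θ : Stage13RParams F N) (h : θ.Provisos₁₃CoPR F N) (W₀ : B12.RunParams → PrintedCarriers15) :
    datumOfRecord₁₃CoPR F N (θ.pinW F N W₀) (h.pinW W₀) = datumOfRecord₁₃CoPR F N θ h := rfl

/-- … the [B8] pin (`rfl`) … [cite: Balaban1989LargeFieldII, Thm 1 + (0.1) pp.355–356 (bookkeeping)] -/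
theorem datumOfRecord₁₃CoPR_pinB8 (θ : Stage13RParams F N) (h : θ.Provisos₁₃CoPR F N) (lam : ResidB8 θ.toStage3Params) :
    datumOfRecord₁₃CoPR F N (θ.pinB8 F N lam) (h.pinB8 lam) = datumOfRecord₁₃CoPR F N θ h :=
  datumOfRecord₁₃CoPR_rebindX F N θ h _ (h.pinB8 lam)

/-- … the [B12] pin (`rfl`) … [cite: Balaban1989LargeFieldII, Thm 1 + (0.1) pp.355–356 (bookkeeping)] -/
theorem datumOfRecord₁₃CoPR_pinB12 (θ : Stage13RParams F N) (h : θ.Provisos₁₃CoPR F N) (lam : ResidB12 F N θ.τ9.M) :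
    datumOfRecord₁₃CoPR F N (θ.pinB12 F N lam) (h.pinB12 lam) = datumOfRecord₁₃CoPR F N θ h :=
  datumOfRecord₁₃CoPR_rebindX F N θ h _ (h.pinB12 lam)

/-- … the [B8′] pin (`rfl`) … [cite: Balaban1989LargeFieldII, Thm 1 + (0.1) pp.355–356 (bookkeeping)] -/
theorem datumOfRecord₁₃CoPR_pinB8Sub (θ : Stage13RParams F N) (h : θ.Provisos₁₃CoPR F N) (lam : ResidB8 θ.toStage3Params) :
    datumOfRecord₁₃CoPR F N (θ.pinB8Sub F N lam) (h.pinB8Sub lam) = datumOfRecord₁₃CoPR F N θ h :=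
  datumOfRecord₁₃CoPR_rebindX F N θ h _ (h.pinB8Sub lam)

/-- … the [B13] pin (`rfl`) … [cite: Balaban1989LargeFieldII, Thm 1 + (0.1) pp.355–356 (bookkeeping)] -/
theorem datumOfRecord₁₃CoPR_pinB13 (θ : Stage13RParams F N) (h : θ.Provisos₁₃CoPR F N) (lam : B12.RunParams → ResidB13 θ.toStage3Params) :
    datumOfRecord₁₃CoPR F N (θ.pinB13 F N lam) (h.pinB13 lam) = datumOfRecord₁₃CoPR F N θ h :=
  datumOfRecord₁₃CoPR_rebindX F N θ h _ (h.pinB13 lam)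

/-- … and the one-level X-pin (`rfl`). [cite: Balaban1989LargeFieldII, Thm 1 + (0.1) pp.355–356 (bookkeeping)] -/
theorem datumOfRecord₁₃CoPR_pinX3 (θ : Stage13RParams F N) (h : θ.Provisos₁₃CoPR F N) (lam8 : ResidB8 θ.toStage3Params) (lam12 : ResidB12 F N θ.τ9.M)
    (lam13 : B12.RunParams → ResidB13 θ.toStage3Params) :
    datumOfRecord₁₃CoPR F N (θ.pinX3 F N lam8 lam12 lam13) (h.pinX3 lam8 lam12 lam13) = datumOfRecord₁₃CoPR F N θ h :=
  datumOfRecord₁₃CoPR_rebindX F N θ h _ (h.pinX3 lam8 lam12 lam13)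

/-- … and the repaired one-level X-pin (`rfl`). [cite: Balaban1989LargeFieldII, Thm 1 + (0.1) pp.355–356 (bookkeeping)] -/
theorem datumOfRecord₁₃CoPR_pinX3H (θ : Stage13RParams F N) (h : θ.Provisos₁₃CoPR F N) (lam8 : ResidB8 θ.toStage3Params) (lam12 : ResidB12 F N θ.τ9.M)
    (lam13 : B12.RunParams → ResidB13 θ.toStage3Params) :
    datumOfRecord₁₃CoPR F N (θ.pinX3H F N lam8 lam12 lam13) (h.pinX3H lam8 lam12 lam13) = datumOfRecord₁₃CoPR F N θ h :=
  datumOfRecord₁₃CoPR_rebindX F N θ h _ (h.pinX3H lam8 lam12 lam13)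

end Datum

/-! ## §3. The v1.6 CORE record `IsRecordOfRecord₁₃CCoPR` presented at a re-bound ∕ pinned Stage-13 view (same datum by §2) -/

section Records

/-- **Pointed form, generic re-binding, Co-BACKGROUND CORE vocabulary**: a world with def-T's pointed clauses — construction `(datumOfRecord₁₃CoPR θ h).C`, window `0 < w.γ ≤ θ.γ`, block size
`θ.L` — whose upstream blocks are the C-binding over the Stage-13 view of the RE-BOUND parameters IS a v1.6 core ₁₃C record at `datumOfRecord₁₃CoPR θ h` (presenting parameter
`θ.rebindX X'`). [cite: Balaban1989LargeFieldII, Thm 1 + (0.1) pp.355–356 (bookkeeping)] -/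
theorem isRecordOfRecord₁₃CCoPR_rebindX_of_eq (θ : Stage13RParams F N) (h : θ.Provisos₁₃CoPR F N) (hθ : θ.Admissible F N) (X' : B12.RunParams → PrintedCarriersR)
    (w : WorldP) (hC : w.C = (datumOfRecord₁₃CoPR F N θ h).C) (hγ : 0 < w.γ ∧ w.γ ≤ θ.γ) (hL : w.L = (θ.L : ℝ))
    (hup : ∀ P, w.up P = upOfRecord₅C F N ((θ.rebindX F N X').toStage5₁₃CoPR F N) P) :
    IsRecordOfRecord₁₃CCoPR F N (datumOfRecord₁₃CoPR F N θ h) w :=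
  ⟨θ.rebindX F N X', h.rebindX X', (Stage13RParams.rebindX_admissible_iff F N θ X').2 hθ, (datumOfRecord₁₃CoPR_rebindX F N θ h X' (h.rebindX X')).symm,
    hC, hγ, hL, hup⟩

/-- **EVERY admissible Stage-13 parameter with the CORE provisos (print's background) presents a v1.6 core ₁₃C record at its own datum whose world is bound over ANY re-bound Stage-13 view**, any
window `0 < γw ≤ θ.γ`, block size `θ.L`. [cite: Balaban1989LargeFieldII, Thm 1 + (0.1) pp.355–356 (bookkeeping)] -/
theorem exists_world_isRecordOfRecord₁₃CCoPR_rebindX (θ : Stage13RParams F N) (h : θ.Provisos₁₃CoPR F N) (hθ : θ.Admissible F N) (X' : B12.RunParams → PrintedCarriersR)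
    {γw : ℝ} (hγw : 0 < γw ∧ γw ≤ θ.γ) :
    ∃ w : WorldP, IsRecordOfRecord₁₃CCoPR F N (datumOfRecord₁₃CoPR F N θ h) w ∧ w.γ = γw ∧ w.L = (θ.L : ℝ) ∧
      ∀ P, w.up P = upOfRecord₅C F N ((θ.rebindX F N X').toStage5₁₃CoPR F N) P := by
  obtain ⟨w₀⟩ := nonempty_worldP
  exact ⟨{ w₀ with
      C := (datumOfRecord₁₃CoPR F N θ h).C, γ := γw, L := (θ.L : ℝ), one_lt_L := by exact_mod_cast θ.hL.2,
      up := fun P => upOfRecord₅C F N ((θ.rebindX F N X').toStage5₁₃CoPR F N) P },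
    isRecordOfRecord₁₃CCoPR_rebindX_of_eq F N θ h hθ X' _ rfl hγw rfl (fun _ => rfl), rfl, rfl, fun _ => rfl⟩

/-- The [B10] instance (dag-n08-c's N08 ₁₃ storeys read it by name). [cite: Balaban1989LargeFieldII, Thm 1 + (0.1) pp.355–356; Balaban1985UV3, Thm 1 p.257 (bookkeeping)] -/
theorem isRecordOfRecord₁₃CCoPR_pinB10_of_eq (θ : Stage13RParams F N) (h : θ.Provisos₁₃CoPR F N) (hθ : θ.Admissible F N)
    (w : WorldP) (hC : w.C = (datumOfRecord₁₃CoPR F N θ h).C) (hγ : 0 < w.γ ∧ w.γ ≤ θ.γ) (hL : w.L = (θ.L : ℝ))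
    (hup : ∀ P, w.up P = upOfRecord₅C F N ((θ.pinB10 F N).toStage5₁₃CoPR F N) P) :
    IsRecordOfRecord₁₃CCoPR F N (datumOfRecord₁₃CoPR F N θ h) w :=
  isRecordOfRecord₁₃CCoPR_rebindX_of_eq F N θ h hθ _ w hC hγ hL hup

/-- The [B13] instance (this seat's N10 ₁₃ storeys read it by name). [cite: Balaban1989LargeFieldII, Thm 1 + (0.1) pp.355–356; Balaban1988RG2Cluster, Lemmas 1–3 pp.9–20 (bookkeeping)] -/
theorem isRecordOfRecord₁₃CCoPR_pinB13_of_eq (θ : Stage13RParams F N) (h : θ.Provisos₁₃CoPR F N) (hθ : θ.Admissible F N)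
    (lam : B12.RunParams → ResidB13 θ.toStage3Params) (w : WorldP) (hC : w.C = (datumOfRecord₁₃CoPR F N θ h).C) (hγ : 0 < w.γ ∧ w.γ ≤ θ.γ) (hL : w.L = (θ.L : ℝ))
    (hup : ∀ P, w.up P = upOfRecord₅C F N ((θ.pinB13 F N lam).toStage5₁₃CoPR F N) P) :
    IsRecordOfRecord₁₃CCoPR F N (datumOfRecord₁₃CoPR F N θ h) w :=
  isRecordOfRecord₁₃CCoPR_rebindX_of_eq F N θ h hθ _ w hC hγ hL hup

/-- The X-pinned instance (dag-n24-c's K1 engine closers read it by name). [cite: Balaban1989LargeFieldII, Thm 1 + (0.1) pp.355–356 (bookkeeping)] -/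
theorem isRecordOfRecord₁₃CCoPR_pinX3_of_eq (θ : Stage13RParams F N) (h : θ.Provisos₁₃CoPR F N) (hθ : θ.Admissible F N) (lam8 : ResidB8 θ.toStage3Params)
    (lam12 : ResidB12 F N θ.τ9.M) (lam13 : B12.RunParams → ResidB13 θ.toStage3Params) (w : WorldP) (hC : w.C = (datumOfRecord₁₃CoPR F N θ h).C)
    (hγ : 0 < w.γ ∧ w.γ ≤ θ.γ) (hL : w.L = (θ.L : ℝ)) (hup : ∀ P, w.up P = upOfRecord₅C F N ((θ.pinX3 F N lam8 lam12 lam13).toStage5₁₃CoPR F N) P) :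
    IsRecordOfRecord₁₃CCoPR F N (datumOfRecord₁₃CoPR F N θ h) w :=
  isRecordOfRecord₁₃CCoPR_rebindX_of_eq F N θ h hθ _ w hC hγ hL hup

/-- The REPAIRED X-pinned instance (the [B8″H] closers read it by name). [cite: Balaban1989LargeFieldII, Thm 1 + (0.1) pp.355–356 (bookkeeping)] -/
theorem isRecordOfRecord₁₃CCoPR_pinX3H_of_eq (θ : Stage13RParams F N) (h : θ.Provisos₁₃CoPR F N) (hθ : θ.Admissible F N) (lam8 : ResidB8 θ.toStage3Params)
    (lam12 : ResidB12 F N θ.τ9.M) (lam13 : B12.RunParams → ResidB13 θ.toStage3Params) (w : WorldP) (hC : w.C = (datumOfRecord₁₃CoPR F N θ h).C)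
    (hγ : 0 < w.γ ∧ w.γ ≤ θ.γ) (hL : w.L = (θ.L : ℝ)) (hup : ∀ P, w.up P = upOfRecord₅C F N ((θ.pinX3H F N lam8 lam12 lam13).toStage5₁₃CoPR F N) P) :
    IsRecordOfRecord₁₃CCoPR F N (datumOfRecord₁₃CoPR F N θ h) w :=
  isRecordOfRecord₁₃CCoPR_rebindX_of_eq F N θ h hθ _ w hC hγ hL hup

/-- Every admissible Stage-13 parameter with the CORE provisos (print's background) presents a v1.6 core ₁₃C record of its own datum over the X-pinned Stage-13 view, any window `0 < γw ≤ θ.γ`,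
block size `θ.L`. [cite: Balaban1989LargeFieldII, Thm 1 + (0.1) pp.355–356 (bookkeeping)] -/
theorem exists_world_isRecordOfRecord₁₃CCoPR_pinX3 (θ : Stage13RParams F N) (h : θ.Provisos₁₃CoPR F N) (hθ : θ.Admissible F N) (lam8 : ResidB8 θ.toStage3Params)
    (lam12 : ResidB12 F N θ.τ9.M) (lam13 : B12.RunParams → ResidB13 θ.toStage3Params) {γw : ℝ} (hγw : 0 < γw ∧ γw ≤ θ.γ) :
    ∃ w : WorldP, IsRecordOfRecord₁₃CCoPR F N (datumOfRecord₁₃CoPR F N θ h) w ∧ w.γ = γw ∧ w.L = (θ.L : ℝ) ∧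
      ∀ P, w.up P = upOfRecord₅C F N ((θ.pinX3 F N lam8 lam12 lam13).toStage5₁₃CoPR F N) P :=
  exists_world_isRecordOfRecord₁₃CCoPR_rebindX F N θ h hθ _ hγw

end Records

/-! ## §4. N10 at a run bound to the C-binding of the [B13]-pinned `CoPR` view -/

section Pin13

variable {F N}

/-- **N10 AT A RUN BOUND TO THE C-BINDING OF THE [B13]-PINNED STAGE-13 VIEW** (`CarriersB13.b13_main_iff_rebindX_XB13OfRecord` at `φ := θ.toStage5₁₃CoPR`, through `toStage5₁₃CoPR_pinB13`):
«b9 → b10 → b11 → b12 → b13» with `b13` THE LEAF AT THE GROUP OF RECORD, the in-edges at `θ`'s (residual) carriers `res.Y ∕ res.X ∕ res.Z` (the Stage-13 view keeps them, `rfl`).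
[cite: Balaban1988RG2Cluster, Lemmas 1–3 pp.9, 11, 20 (the node at the objects of record)] -/
theorem b13_main_iff_toStage5₁₃CoPR_pinB13 (θ : Stage13RParams F N) (lam : B12.RunParams → ResidB13 θ.toStage3Params) (w : WorldP) (P : B12.RunParams)
    (hup : w.up P = upOfRecord₅C F N ((θ.pinB13 F N lam).toStage5₁₃CoPR F N) P) :
    Dag.B13_main (leavesP w P) ↔
      (B9LeafX (θ.res.Y P) → (B10.Thm1PrintedCompact (θ.res.X P).runs10 ∧ B10.Thm2Printed (θ.res.X P).runs10) → B11Leaf (θ.res.Z P) →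
        B12Sec2to5.Lemma4Printed (θ.res.X P).F12 (θ.res.X P).c12 → B13LeafOfRecord θ.toStage3Params (lam P)) := by
  rw [Stage13RParams.toStage5₁₃CoPR_pinB13] at hup
  exact b13_main_iff_rebindX_XB13OfRecord (θ.toStage5₁₃CoPR F N) lam θ.res.X w P hup

/-- **N10 AT `(w, P)` FROM THE TORUS LEAF TRIPLE AT THE STEP OF RECORD, at the C-binding of the [B13]-pinned Stage-13 view** (`CarriersB13.b13_main_at_rebindX_XB13OfRecord` at
`φ := θ.toStage5₁₃CoPR`). [cite: Balaban1988RG2Cluster, Lemma 1 p.9, Lemma 2 p.11, Lemma 3 p.20] -/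
theorem b13_main_at_toStage5₁₃CoPR_pinB13 (θ : Stage13RParams F N) (lam : B12.RunParams → ResidB13 θ.toStage3Params) (w : WorldP) (P : B12.RunParams)
    (hup : w.up P = upOfRecord₅C F N ((θ.pinB13 F N lam).toStage5₁₃CoPR F N) P)
    (hleaf : B9LeafX (θ.res.Y P) → (B10.Thm1PrintedCompact (θ.res.X P).runs10 ∧ B10.Thm2Printed (θ.res.X P).runs10) → B11Leaf (θ.res.Z P) →
      B12Sec2to5.Lemma4Printed (θ.res.X P).F12 (θ.res.X P).c12 →
        B13.Lemma1Printed (WtOfRecord θ.toStage3Params (lam P)).toStepData (c13OfRecord θ.toStage3Params (lam P)) ∧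
          B13.Lemma2Printed (WtOfRecord θ.toStage3Params (lam P)).toStepData (c13OfRecord θ.toStage3Params (lam P)) ∧
            B13.Lemma3Printed (WtOfRecord θ.toStage3Params (lam P)).toStepData (c13OfRecord θ.toStage3Params (lam P))) :
    Dag.B13_main (leavesP w P) := by
  rw [Stage13RParams.toStage5₁₃CoPR_pinB13] at hup
  exact b13_main_at_rebindX_XB13OfRecord (θ.toStage5₁₃CoPR F N) lam θ.res.X w P hup hleaf

end Pin13

/-! ## §5. The five cumulative v1.6 VIEWS (definitions) with their leaves by name -/

section Views

/-- **The cumulative four-pin Stage-13 view**: `θ.toStage5₁₃CoPR` pinned by `pinB10`, then `pinY (Y9OfRecord …)`, then `pinZ (Z11OfRecord F N ζ)`, then `pinW (WOfRecord₁₃ θ lamW)`.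
[cite: Balaban1985UV3, Thm 1 p.257; Balaban1985BackgroundPropagators, Thm 3.1 p.397; Balaban1985Variational, Thm 1 p.279; Balaban1989LargeFieldI, (0.2) p.176 (objects of record)] -/
def Stage13RParams.view₁₃CoPRB10YZW (θ : Stage13RParams F N) (Mstar : ℕ) (ops : OpsY N θ.toStage3Params Mstar) (ζ : ResidZ F N) (lamW : ResidW F N) :
    Stage5Params F N :=
  ((((θ.toStage5₁₃CoPR F N).pinB10 F N).pinY F N (Y9OfRecord N θ.toStage3Params Mstar ops)).pinZ F N (Z11OfRecord F N ζ)).pinW F N (WOfRecord₁₃ F N θ.toStage13Params lamW)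

/-- The four-pin view IS the Stage-13 view of the QUADRUPLY PINNED parameters (composed from the single-pin `rfl`s). [cite: Balaban1989LargeFieldII, Thm 1 p.355 (bookkeeping)] -/
theorem Stage13RParams.view₁₃CoPRB10YZW_eq (θ : Stage13RParams F N) (Mstar : ℕ) (ops : OpsY N θ.toStage3Params Mstar) (ζ : ResidZ F N) (lamW : ResidW F N) :
    θ.view₁₃CoPRB10YZW F N Mstar ops ζ lamW =
      ((((θ.pinB10 F N).pinY F N (Y9OfRecord N θ.toStage3Params Mstar ops)).pinZ F N (Z11OfRecord F N ζ)).pinW F N (WOfRecord₁₃ F N θ.toStage13Params lamW)).toStage5₁₃CoPR F N := by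
  rw [Stage13RParams.toStage5₁₃CoPR_pinW, Stage13RParams.toStage5₁₃CoPR_pinZ, Stage13RParams.toStage5₁₃CoPR_pinY, Stage13RParams.toStage5₁₃CoPR_pinB10]
  rfl

/-- The leaves of the C-binding over the four-pin view, by name. [cite: Balaban1989LargeFieldI, Prop. 1 p.194; Balaban1985Variational, Thm 1 p.279; Balaban1985BackgroundPropagators, Thm 3.1 p.397; Balaban1985UV3, Thm 1 p.257 + Thm 2 p.272] -/
theorem upOfRecord₅C_view₁₃CoPRB10YZW_leaves (θ : Stage13RParams F N) (Mstar : ℕ) (ops : OpsY N θ.toStage3Params Mstar) (ζ : ResidZ F N) (lamW : ResidW F N) (P : B12.RunParams) :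
    ((upOfRecord₅C F N (θ.view₁₃CoPRB10YZW F N Mstar ops ζ lamW) P).rBasicStep ↔ B15Leaf (WOfRecord₁₃ F N θ.toStage13Params lamW P)) ∧
    ((upOfRecord₅C F N (θ.view₁₃CoPRB10YZW F N Mstar ops ζ lamW) P).b9 ↔ B9LeafX (Y9OfRecord N θ.toStage3Params Mstar ops)) ∧
    ((upOfRecord₅C F N (θ.view₁₃CoPRB10YZW F N Mstar ops ζ lamW) P).b10 ↔ PrintedUV3V N θ.L) ∧
    ((upOfRecord₅C F N (θ.view₁₃CoPRB10YZW F N Mstar ops ζ lamW) P).b11 ↔ B11Leaf (Z11OfRecord F N ζ)) := by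
  have hw := upOfRecord₅C_pinW_b9_b10_b11 F N ((((θ.toStage5₁₃CoPR F N).pinB10 F N).pinY F N (Y9OfRecord N θ.toStage3Params Mstar ops)).pinZ F N (Z11OfRecord F N ζ))
    (WOfRecord₁₃ F N θ.toStage13Params lamW) P
  refine ⟨upOfRecord₅C_pinW_rBasicStep_iff F N _ _ P, ?_, ?_, ?_⟩
  · unfold Stage13RParams.view₁₃CoPRB10YZW
    rw [hw.1, upOfRecord₅C_pinZ_b9]
    exact upOfRecord₅C_pinY_b9_iff F N _ _ P
  · unfold Stage13RParams.view₁₃CoPRB10YZW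
    rw [hw.2.1, upOfRecord₅C_pinZ_b10, upOfRecord₅C_pinY_b10]
    exact upOfRecord₅C_pinB10_b10_iff F N (θ.toStage5₁₃CoPR F N) P
  · unfold Stage13RParams.view₁₃CoPRB10YZW
    rw [hw.2.2]
    exact upOfRecord₅C_pinZ_b11_iff F N _ _ P

/-- **The five-pin Stage-13 view with [B8]** ([B8] innermost). [cite: Balaban1985RegularSpaces, Thm 2 p.83 (objects of record)] -/
def Stage13RParams.view₁₃CoPRB8B10YZW (θ : Stage13RParams F N) (lam : ResidB8 θ.toStage3Params) (Mstar : ℕ) (ops : OpsY N θ.toStage3Params Mstar) (ζ : ResidZ F N)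
    (lamW : ResidW F N) : Stage5Params F N :=
  (θ.pinB8 F N lam).view₁₃CoPRB10YZW F N Mstar ops ζ lamW

/-- The leaves of the S-binding over the five-pin view, by name (`b8` is `Iff.rfl`; the other four are the four-pin faces at `θ.pinB8 lam`).
[cite: Balaban1985RegularSpaces, Lemma 1 – Thm 8 pp.79–101; Balaban1989LargeFieldI, Prop. 1 p.194; Balaban1985BackgroundPropagators, Thm 3.1 p.397; Balaban1985UV3, Thm 1 p.257; Balaban1985Variational, Thm 1 p.279] -/
theorem upOfRecord₅CS_view₁₃CoPRB8B10YZW_leaves (θ : Stage13RParams F N) (lam : ResidB8 θ.toStage3Params) (Mstar : ℕ) (ops : OpsY N θ.toStage3Params Mstar)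
    (ζ : ResidZ F N) (lamW : ResidW F N) (P : B12.RunParams) :
    ((upOfRecord₅CS F N (θ.view₁₃CoPRB8B10YZW F N lam Mstar ops ζ lamW) P).b8 ↔ B8LeafOfRecord θ.toStage3Params lam) ∧
    ((upOfRecord₅CS F N (θ.view₁₃CoPRB8B10YZW F N lam Mstar ops ζ lamW) P).rBasicStep ↔ B15Leaf (WOfRecord₁₃ F N θ.toStage13Params lamW P)) ∧
    ((upOfRecord₅CS F N (θ.view₁₃CoPRB8B10YZW F N lam Mstar ops ζ lamW) P).b9 ↔ B9LeafX (Y9OfRecord N θ.toStage3Params Mstar ops)) ∧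
    ((upOfRecord₅CS F N (θ.view₁₃CoPRB8B10YZW F N lam Mstar ops ζ lamW) P).b10 ↔ PrintedUV3V N θ.L) ∧
    ((upOfRecord₅CS F N (θ.view₁₃CoPRB8B10YZW F N lam Mstar ops ζ lamW) P).b11 ↔ B11Leaf (Z11OfRecord F N ζ)) :=
  ⟨Iff.rfl, upOfRecord₅C_view₁₃CoPRB10YZW_leaves F N (θ.pinB8 F N lam) Mstar ops ζ lamW P⟩

/-- … and the C-binding's `b8` over the five-pin view is the leaf AS TYPED at the group of record (`Iff.rfl`). [cite: Balaban1985RegularSpaces, Lemma 1 – Thm 8 pp.79–101 (bookkeeping)] -/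
theorem upOfRecord₅C_view₁₃CoPRB8B10YZW_b8_iff (θ : Stage13RParams F N) (lam : ResidB8 θ.toStage3Params) (Mstar : ℕ) (ops : OpsY N θ.toStage3Params Mstar)
    (ζ : ResidZ F N) (lamW : ResidW F N) (P : B12.RunParams) :
    (upOfRecord₅C F N (θ.view₁₃CoPRB8B10YZW F N lam Mstar ops ζ lamW) P).b8 ↔
      B8LeafR θ.D (θ.L : ℝ) lam.C₂ lam.B₁' lam.inp.B₀' lam.B₁ lam.B₂ lam.c₁ lam.inp lam.B₀β (B8Lemma1NonAbelian.blockPairNA θ.D θ.L θ.𝔸)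
        (famB8OfRecord θ.toStage3Params lam.β lam.len) lam.lan lam.cub lam.toAxial :=
  Iff.rfl

/-- **The six-pin Stage-13 view** ([B12] innermost, then the five-pin view with [B8]). [cite: Balaban1987RG1, Lemma 4 p.280; Balaban1985RegularSpaces, Thm 2 p.83 (objects of record)] -/
def Stage13RParams.view₁₃CoPRB12B8B10YZW (θ : Stage13RParams F N) (lam12 : ResidB12 F N θ.τ9.M) (lam : ResidB8 θ.toStage3Params) (Mstar : ℕ)
    (ops : OpsY N θ.toStage3Params Mstar) (ζ : ResidZ F N) (lamW : ResidW F N) : Stage5Params F N :=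
  (θ.pinB12 F N lam12).view₁₃CoPRB8B10YZW F N lam Mstar ops ζ lamW

/-- **The five-pin Stage-13 view with [B8′]** ([B8′] innermost). [cite: Balaban1985RegularSpaces, Thm 2 p.83 (objects of record)] -/
def Stage13RParams.view₁₃CoPRB8subB10YZW (θ : Stage13RParams F N) (lam : ResidB8 θ.toStage3Params) (Mstar : ℕ) (ops : OpsY N θ.toStage3Params Mstar) (ζ : ResidZ F N)
    (lamW : ResidW F N) : Stage5Params F N :=
  (θ.pinB8Sub F N lam).view₁₃CoPRB10YZW F N Mstar ops ζ lamW

/-- **The six-pin Stage-13 view with [B12] and [B8′]** ([B12] innermost). [cite: Balaban1987RG1, Lemma 4 p.280; Balaban1985RegularSpaces, Thm 2 p.83 (objects of record)] -/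
def Stage13RParams.view₁₃CoPRB12B8subB10YZW (θ : Stage13RParams F N) (lam12 : ResidB12 F N θ.τ9.M) (lam : ResidB8 θ.toStage3Params) (Mstar : ℕ)
    (ops : OpsY N θ.toStage3Params Mstar) (ζ : ResidZ F N) (lamW : ResidW F N) : Stage5Params F N :=
  (θ.pinB12 F N lam12).view₁₃CoPRB8subB10YZW F N lam Mstar ops ζ lamW

/-- **THE SIX LEAVES OF THE S-BINDING OVER THE SIX-PIN VIEW**, by name (`b12`, `b8` by `Iff.rfl`; the [B12] leaf is the Stage-12 one at `θ.toStage12Params`). [cite: Balaban1987RG1, Lemma 4 p.280; Balaban1985RegularSpaces, Lemma 1 – Thm 8 pp.79–101; Balaban1989LargeFieldI, Prop. 1 p.194; Balaban1985BackgroundPropagators, Thm 3.1 p.397; Balaban1985UV3, Thm 1 p.257; Balaban1985Variational, Thm 1 p.279] -/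
theorem upOfRecord₅CS_view₁₃CoPRB12B8B10YZW_leaves (θ : Stage13RParams F N) (lam12 : ResidB12 F N θ.τ9.M) (lam : ResidB8 θ.toStage3Params) (Mstar : ℕ)
    (ops : OpsY N θ.toStage3Params Mstar) (ζ : ResidZ F N) (lamW : ResidW F N) (P : B12.RunParams) :
    ((upOfRecord₅CS F N (θ.view₁₃CoPRB12B8B10YZW F N lam12 lam Mstar ops ζ lamW) P).b12 ↔ B12LeafOfRecord₁₂ F N θ.toStage12Params lam12 P) ∧
    ((upOfRecord₅CS F N (θ.view₁₃CoPRB12B8B10YZW F N lam12 lam Mstar ops ζ lamW) P).b8 ↔ B8LeafOfRecord θ.toStage3Params lam) ∧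
    ((upOfRecord₅CS F N (θ.view₁₃CoPRB12B8B10YZW F N lam12 lam Mstar ops ζ lamW) P).rBasicStep ↔ B15Leaf (WOfRecord₁₃ F N θ.toStage13Params lamW P)) ∧
    ((upOfRecord₅CS F N (θ.view₁₃CoPRB12B8B10YZW F N lam12 lam Mstar ops ζ lamW) P).b9 ↔ B9LeafX (Y9OfRecord N θ.toStage3Params Mstar ops)) ∧
    ((upOfRecord₅CS F N (θ.view₁₃CoPRB12B8B10YZW F N lam12 lam Mstar ops ζ lamW) P).b10 ↔ PrintedUV3V N θ.L) ∧
    ((upOfRecord₅CS F N (θ.view₁₃CoPRB12B8B10YZW F N lam12 lam Mstar ops ζ lamW) P).b11 ↔ B11Leaf (Z11OfRecord F N ζ)) :=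
  ⟨Iff.rfl, upOfRecord₅CS_view₁₃CoPRB8B10YZW_leaves F N (θ.pinB12 F N lam12) lam Mstar ops ζ lamW P⟩

/-- The leaves of the S-binding over the five-pin view with [B8′], by name (`b8` is `Iff.rfl`). [cite: Balaban1985RegularSpaces, Lemma 1 – Thm 8 pp.79–101; Balaban1989LargeFieldI, Prop. 1 p.194; Balaban1985BackgroundPropagators, Thm 3.1 p.397; Balaban1985UV3, Thm 1 p.257; Balaban1985Variational, Thm 1 p.279] -/
theorem upOfRecord₅CS_view₁₃CoPRB8subB10YZW_leaves (θ : Stage13RParams F N) (lam : ResidB8 θ.toStage3Params) (Mstar : ℕ) (ops : OpsY N θ.toStage3Params Mstar)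
    (ζ : ResidZ F N) (lamW : ResidW F N) (P : B12.RunParams) :
    ((upOfRecord₅CS F N (θ.view₁₃CoPRB8subB10YZW F N lam Mstar ops ζ lamW) P).b8 ↔ B8LeafOfRecordSub θ.toStage3Params lam) ∧
    ((upOfRecord₅CS F N (θ.view₁₃CoPRB8subB10YZW F N lam Mstar ops ζ lamW) P).rBasicStep ↔ B15Leaf (WOfRecord₁₃ F N θ.toStage13Params lamW P)) ∧
    ((upOfRecord₅CS F N (θ.view₁₃CoPRB8subB10YZW F N lam Mstar ops ζ lamW) P).b9 ↔ B9LeafX (Y9OfRecord N θ.toStage3Params Mstar ops)) ∧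
    ((upOfRecord₅CS F N (θ.view₁₃CoPRB8subB10YZW F N lam Mstar ops ζ lamW) P).b10 ↔ PrintedUV3V N θ.L) ∧
    ((upOfRecord₅CS F N (θ.view₁₃CoPRB8subB10YZW F N lam Mstar ops ζ lamW) P).b11 ↔ B11Leaf (Z11OfRecord F N ζ)) :=
  ⟨Iff.rfl, upOfRecord₅C_view₁₃CoPRB10YZW_leaves F N (θ.pinB8Sub F N lam) Mstar ops ζ lamW P⟩

/-- … and the C-binding's `b8` over it is the leaf AS TYPED at the re-keyed group of record (`Iff.rfl`). [cite: Balaban1985RegularSpaces, Lemma 1 – Thm 8 pp.79–101 (bookkeeping)] -/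
theorem upOfRecord₅C_view₁₃CoPRB8subB10YZW_b8_iff (θ : Stage13RParams F N) (lam : ResidB8 θ.toStage3Params) (Mstar : ℕ) (ops : OpsY N θ.toStage3Params Mstar)
    (ζ : ResidZ F N) (lamW : ResidW F N) (P : B12.RunParams) :
    (upOfRecord₅C F N (θ.view₁₃CoPRB8subB10YZW F N lam Mstar ops ζ lamW) P).b8 ↔
      B8LeafR θ.D (θ.L : ℝ) lam.C₂ lam.B₁' lam.inp.B₀' lam.B₁ lam.B₂ lam.c₁ lam.inp lam.B₀β (B8Lemma1NonAbelian.blockPairNA θ.D θ.L θ.𝔸)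
        (fun j : IdxB8Sub θ.toStage3Params => famB8OfRecord θ.toStage3Params lam.β lam.len j.1) lam.lan lam.cub (fun j => lam.toAxial j.1) :=
  Iff.rfl

/-- **THE SIX LEAVES OF THE S-BINDING OVER THE SIX-PIN VIEW WITH [B8′]**, by name (`b12`, `b8` by `Iff.rfl`). [cite: Balaban1987RG1, Lemma 4 p.280; Balaban1985RegularSpaces, Lemma 1 – Thm 8 pp.79–101; Balaban1989LargeFieldI, Prop. 1 p.194; Balaban1985BackgroundPropagators, Thm 3.1 p.397; Balaban1985UV3, Thm 1 p.257; Balaban1985Variational, Thm 1 p.279] -/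
theorem upOfRecord₅CS_view₁₃CoPRB12B8subB10YZW_leaves (θ : Stage13RParams F N) (lam12 : ResidB12 F N θ.τ9.M) (lam : ResidB8 θ.toStage3Params) (Mstar : ℕ)
    (ops : OpsY N θ.toStage3Params Mstar) (ζ : ResidZ F N) (lamW : ResidW F N) (P : B12.RunParams) :
    ((upOfRecord₅CS F N (θ.view₁₃CoPRB12B8subB10YZW F N lam12 lam Mstar ops ζ lamW) P).b12 ↔ B12LeafOfRecord₁₂ F N θ.toStage12Params lam12 P) ∧
    ((upOfRecord₅CS F N (θ.view₁₃CoPRB12B8subB10YZW F N lam12 lam Mstar ops ζ lamW) P).b8 ↔ B8LeafOfRecordSub θ.toStage3Params lam) ∧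
    ((upOfRecord₅CS F N (θ.view₁₃CoPRB12B8subB10YZW F N lam12 lam Mstar ops ζ lamW) P).rBasicStep ↔ B15Leaf (WOfRecord₁₃ F N θ.toStage13Params lamW P)) ∧
    ((upOfRecord₅CS F N (θ.view₁₃CoPRB12B8subB10YZW F N lam12 lam Mstar ops ζ lamW) P).b9 ↔ B9LeafX (Y9OfRecord N θ.toStage3Params Mstar ops)) ∧
    ((upOfRecord₅CS F N (θ.view₁₃CoPRB12B8subB10YZW F N lam12 lam Mstar ops ζ lamW) P).b10 ↔ PrintedUV3V N θ.L) ∧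
    ((upOfRecord₅CS F N (θ.view₁₃CoPRB12B8subB10YZW F N lam12 lam Mstar ops ζ lamW) P).b11 ↔ B11Leaf (Z11OfRecord F N ζ)) :=
  ⟨Iff.rfl, upOfRecord₅CS_view₁₃CoPRB8subB10YZW_leaves F N (θ.pinB12 F N lam12) lam Mstar ops ζ lamW P⟩

end Views

end Literature.MathematicalPhysics.QuantumFieldTheory.Balaban1983to89.Node00

end
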